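import Literature.MathematicalPhysics.QuantumFieldTheory.OSTimeSlice
import Literature.MathematicalPhysics.QuantumFieldTheory.OSTimeTubeIntegrability
import Literature.MathematicalPhysics.QuantumFieldTheory.OSEuclideanRotationGenerator
import HarnessLib

/-!
# Infinitesimal Euclidean rotation invariance of an OS time continuation, continued to real times

Topic `Literature/MathematicalPhysics/QuantumFieldTheory`; first support file (everything proved) for
the discharge of the named fact (B) `OS1973_lorentzInvariant_of_timeContinuation` of
`Literature.MathematicalPhysics.QuantumFieldTheory.OSTimeContinuation` — Osterwalder–Schrader I
(Comm. Math. Phys. 31 (1973)), §4.2 "Lorentz Covariance and Spectrum Condition": the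
infinitesimal generators `Y_{0i}` of the Euclidean rotations annihilate the Schwinger functions
((4.15), from E1), and this identity is carried over to the boost generators `X_{0i}` acting on the
Wightman distributions ((4.14), (4.16)–(4.17)). OS carry it over through the Fourier–Laplace
representation (4.12); for a function `𝔚` which is only known to be continuous on the time tube
and holomorphic in the time variables (the output of OS II, Thm. 4.3, the hypothesis of (B)) we
carry it over in position space, by analytic continuation in purely temporal complex shifts:

* `rotGenFn i G` — the rotation generator in the `(0, i)`-plane on test functions,
  `(Y_i G)(x) = ∑ₖ (x⁰_k ∂_{e_i,k} G − xⁱ_k ∂_{e₀,k} G)(x)` (`e_{μ,k}` the unit vector `e_μ` in the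
  `k`-th argument, `unitDir k μ`);
* `integral_euclideanPoint_mul_rotGenFn_eq_zero` — **E1, infinitesimally, at Euclidean points**:
  `∫ 𝔚(ιx) (Y_i G)(x) dx = 0` for every Schwartz `G` with compact support in the time-ordered
  region `Ω` (differentiate `φ ↦ ∫ 𝔚(ιx) G(R_{−φ} x) dx = 𝔖ₙ(G ∘ R_{−φ}) = 𝔖ₙ(G)` at `φ = 0`;
  `R_φ = planeRot i φ`, the rotated test function stays time-ordered for small `φ` by the tube
  lemma, the derivative is a dominated parameter integral over a compact set);
* `shiftGenFn i a G`, `timeShiftC a x` — the **complexified generator**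
  `Ξ_a G (x) = ∑ₖ ((a_k + i x⁰_k) ∂_{e_i,k} G − i xⁱ_k ∂_{e₀,k} G)(x)` and the configuration
  `(a_k + i x⁰_k, x⃗_k)_k` of the time tube with complex times shifted by `a ∈ ℂⁿ`
  (`Ξ_0 = i Y_i`, and at imaginary `a = is` both are the Euclidean objects of the time-translated
  test function `G(· − s ê₀)`);
* `integral_timeShiftC_mul_shiftGenFn_eq_zero` — **the identity at real time shifts**:
  `∫ 𝔚((u_k + i x⁰_k, x⃗_k)_k) (Ξ_u G)(x) dx = 0` for all real `u ∈ ℝⁿ`. Proof: the function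
  `λ ↦ ∫ 𝔚((λu_k + i x⁰_k, x⃗_k)_k) (Ξ_{λu} G)(x) dx` is holomorphic on a strip `|Im λ| < δ`
  (dominated holomorphic parameter integral: `𝔚` is holomorphic in the times, `G` has compact
  support inside `Ω`), vanishes at `λ = iμ`, `μ` real and small (there it is `i` times the
  Euclidean identity for `G(· − μ u ê₀)`, by translation invariance of Lebesgue measure), hence
  vanishes identically (identity theorem), in particular at `λ = 1`.

The second file (`OSTimeLorentzBoostGenerator`) integrates this identity against the real times to
obtain `T(X_i G) = 0` for the boost generator `X_i` and the time-ray boundary value `T`; the third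
(`OSTimeLorentz`) integrates the generators to finite Lorentz transformations.

## References

* K. Osterwalder, R. Schrader, *Axioms for Euclidean Green's functions*, Comm. Math. Phys. 31
  (1973) 83–112, §4.2, eqs. (4.14)–(4.17). [OsterwalderSchraderCMP1973]
* K. Osterwalder, R. Schrader, *Axioms for Euclidean Green's functions II*, Comm. Math. Phys. 42
  (1975) 281–305, §IV.2 p. 288 ("The remaining Wightman axioms can be established as in
  Sections 4.2–4.5 of OS I"). [OsterwalderSchraderCMP1975]
-/

noncomputable section

open MeasureTheory Filter Set Metric Complex
open scoped Topology SchwartzMap LineDeriv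
open Literature.MathematicalPhysics.QuantumLattice Literature.Analysis.FunctionSpaces

namespace Literature.MathematicalPhysics.QuantumFieldTheory

variable {d n : ℕ}

/-! ### Unit directions and the rotation generator on test functions -/

/-- The unit vector `e_μ` of `ℝ^{1+d}` placed in the `k`-th argument of an `n`-point
configuration. [folklore] -/
def unitDir (k : Fin n) (μ : Fin (d + 1)) : Fin n → SpaceTime d :=
  Pi.single k (EuclideanSpace.single μ (1 : ℝ))

/-- Components of `unitDir`. [folklore] -/
theorem unitDir_apply (k : Fin n) (μ : Fin (d + 1)) (j : Fin n) (ν : Fin (d + 1)) :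
    unitDir k μ j ν = if j = k ∧ ν = μ then 1 else 0 := by
  unfold unitDir
  by_cases hj : j = k
  · subst hj
    simp
  · simp [hj]

/-- **The generator of the Euclidean rotations in the `(0, i)`-plane on test functions**:
`(Y_i G)(x) = ∑ₖ (x⁰_k (∂_{e_i,k} G)(x) − xⁱ_k (∂_{e₀,k} G)(x))`, the derivative at `φ = 0` of
`G(R_{−φ} x)` for the rotation `R_φ = planeRot i φ` acting diagonally (Osterwalder–Schrader I
(1973), (4.15): the operators `Y_{ij}`). [cite: OsterwalderSchraderCMP1973, §4.2 eq. (4.15)] -/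
def rotGenFn (i : Fin d) (G : 𝓢((Fin n → SpaceTime d), ℂ)) (x : Fin n → SpaceTime d) : ℂ :=
  ∑ k, ((x k 0 : ℂ) * ∂_{unitDir k i.succ} G x - (x k i.succ : ℂ) * ∂_{unitDir k (0 : Fin (d + 1))} G x)

/-- The rotation generator is continuous. [folklore] -/
theorem continuous_rotGenFn (i : Fin d) (G : 𝓢((Fin n → SpaceTime d), ℂ)) :
    Continuous (rotGenFn i G) := by
  unfold rotGenFn
  refine continuous_finsetSum _ fun k _ => ?_
  have hc : ∀ μ : Fin (d + 1), Continuous fun x : Fin n → SpaceTime d => ((x k μ : ℝ) : ℂ) :=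
    fun μ => continuous_ofReal.comp ((EuclideanSpace.proj μ).continuous.comp (continuous_apply k))
  exact ((hc 0).mul (∂_{unitDir k i.succ} G).continuous).sub
    ((hc i.succ).mul (∂_{unitDir k (0 : Fin (d + 1))} G).continuous)

/-- The rotation generator of `G` vanishes off the support of `G`. [folklore] -/
theorem rotGenFn_eq_zero_of_notMem (i : Fin d) (G : 𝓢((Fin n → SpaceTime d), ℂ))
    {x : Fin n → SpaceTime d} (hx : x ∉ tsupport (G : (Fin n → SpaceTime d) → ℂ)) :
    rotGenFn i G x = 0 := by
  unfold rotGenFn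
  refine Finset.sum_eq_zero fun k _ => ?_
  have h0 : fderiv ℝ (G : (Fin n → SpaceTime d) → ℂ) x = 0 := fderiv_of_notMem_tsupport ℝ hx
  simp [SchwartzMap.lineDerivOp_apply_eq_fderiv, h0]

/-- The support of the rotation generator of `G` lies in the support of `G`. [folklore] -/
theorem tsupport_rotGenFn_subset (i : Fin d) (G : 𝓢((Fin n → SpaceTime d), ℂ)) :
    tsupport (rotGenFn i G) ⊆ tsupport (G : (Fin n → SpaceTime d) → ℂ) :=
  closure_minimal (fun _ hx => by_contra fun h => hx (rotGenFn_eq_zero_of_notMem i G h))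
    (isClosed_tsupport _)

/-! ### The rotated configuration and its derivative in the angle -/

/-- The derivative in `φ` of the configuration rotated by `−φ`, `(R_{−φ} x)_k`:
`(−sin φ x⁰ − cos φ xⁱ, cos φ x⁰ − sin φ xⁱ)` in the `(0, i)`-coordinates, `0` elsewhere. [folklore] -/
def rotCurveDeriv (i : Fin d) (x : Fin n → SpaceTime d) (φ : ℝ) : Fin n → SpaceTime d :=
  fun k => WithLp.toLp 2 fun j =>
    if j = 0 then -Real.sin φ * x k 0 - Real.cos φ * x k i.succ
    else if j = i.succ then Real.cos φ * x k 0 - Real.sin φ * x k i.succ else 0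

/-- `φ ↦ R_{−φ} x` is differentiable with derivative `rotCurveDeriv i x φ`. [folklore] -/
theorem hasDerivAt_planeRot_neg_cfg (i : Fin d) (x : Fin n → SpaceTime d) (φ : ℝ) :
    HasDerivAt (fun ψ : ℝ => fun k => planeRot i (-ψ) (x k)) (rotCurveDeriv i x φ) φ := by
  refine hasDerivAt_pi.2 fun k => ?_
  set raw : ℝ → Fin (d + 1) → ℝ := fun ψ j =>
      if j = 0 then Real.cos ψ * x k 0 - Real.sin ψ * x k i.succ
      else if j = i.succ then Real.sin ψ * x k 0 + Real.cos ψ * x k i.succ else x k j with hraw_def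
  set raw' : Fin (d + 1) → ℝ := fun j => if j = 0 then -Real.sin φ * x k 0 - Real.cos φ * x k i.succ
      else if j = i.succ then Real.cos φ * x k 0 - Real.sin φ * x k i.succ else 0 with hraw'_def
  have hraw : HasDerivAt raw raw' φ := by
    refine hasDerivAt_pi.2 fun j => ?_
    by_cases hj : j = 0
    · subst hj
      simp only [hraw_def, hraw'_def, if_true]
      have h := ((Real.hasDerivAt_cos φ).mul_const (x k 0)).sub
        ((Real.hasDerivAt_sin φ).mul_const (x k i.succ))
      exact (h.congr_of_eventuallyEq (Eventually.of_forall fun y => rfl)).congr_deriv (by ring)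
    · by_cases hji : j = i.succ
      · subst hji
        simp only [hraw_def, hraw'_def, Fin.succ_ne_zero, if_false, if_true]
        have h := ((Real.hasDerivAt_sin φ).mul_const (x k 0)).add
          ((Real.hasDerivAt_cos φ).mul_const (x k i.succ))
        exact (h.congr_of_eventuallyEq (Eventually.of_forall fun y => rfl)).congr_deriv (by ring)
      · simp only [hraw_def, hraw'_def, hj, hji, if_false]
        exact hasDerivAt_const _ _
  set L : (Fin (d + 1) → ℝ) →L[ℝ] EuclideanSpace ℝ (Fin (d + 1)) :=
    ((PiLp.continuousLinearEquiv 2 ℝ (fun _ : Fin (d + 1) => ℝ)).symm :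
      (Fin (d + 1) → ℝ) →L[ℝ] EuclideanSpace ℝ (Fin (d + 1))) with hL
  have hLapp : ∀ (f : Fin (d + 1) → ℝ) (j : Fin (d + 1)), (L f) j = f j := fun f j => rfl
  have hcomp := L.hasFDerivAt.comp_hasDerivAt φ hraw
  have hfun : (fun ψ : ℝ => planeRot i (-ψ) (x k)) = L ∘ raw := by
    funext ψ
    ext j
    rw [Function.comp_apply, hLapp, planeRot_apply]
    simp only [hraw_def, Real.cos_neg, Real.sin_neg]
    split_ifs <;> ring
  have hder : rotCurveDeriv i x φ k = L raw' := by
    ext j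
    rw [hLapp]
    rfl
  rw [hfun, hder]
  exact hcomp

/-- `φ ↦ G(R_{−φ} x)` is differentiable, by the chain rule. [folklore] -/
theorem hasDerivAt_apply_planeRot_neg (i : Fin d) (G : 𝓢((Fin n → SpaceTime d), ℂ))
    (x : Fin n → SpaceTime d) (φ : ℝ) :
    HasDerivAt (fun ψ : ℝ => G fun k => planeRot i (-ψ) (x k))
      (fderiv ℝ (G : (Fin n → SpaceTime d) → ℂ) (fun k => planeRot i (-φ) (x k))
        (rotCurveDeriv i x φ)) φ :=
  (G.hasFDerivAt _).comp_hasDerivAt φ (hasDerivAt_planeRot_neg_cfg i x φ)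

/-- At `φ = 0` the derivative of the rotated configuration is `∑ₖ (x⁰_k e_{i,k} − xⁱ_k e_{0,k})`. [folklore] -/
theorem rotCurveDeriv_zero (i : Fin d) (x : Fin n → SpaceTime d) :
    rotCurveDeriv i x 0 =
      ∑ k, ((x k 0) • unitDir k i.succ - (x k i.succ) • unitDir k (0 : Fin (d + 1))) := by
  funext j
  ext ν
  simp only [rotCurveDeriv, Real.sin_zero, Real.cos_zero, zero_mul, one_mul, sub_zero,
    Finset.sum_apply, Pi.sub_apply, Pi.smul_apply, WithLp.ofLp_sum, WithLp.ofLp_sub,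
    WithLp.ofLp_smul, smul_eq_mul, unitDir_apply]
  by_cases hν : ν = 0
  · subst hν
    simp [(Fin.succ_ne_zero i).symm]
  · by_cases hνi : ν = i.succ
    · subst hνi
      simp
    · simp [hν, hνi]

/-- At `φ = 0`, `d/dφ G(R_{−φ} x) = (Y_i G)(x)`. [folklore] -/
theorem fderiv_rotCurveDeriv_zero (i : Fin d) (G : 𝓢((Fin n → SpaceTime d), ℂ))
    (x : Fin n → SpaceTime d) :
    fderiv ℝ (G : (Fin n → SpaceTime d) → ℂ) x (rotCurveDeriv i x 0) = rotGenFn i G x := by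
  rw [rotCurveDeriv_zero, map_sum]
  unfold rotGenFn
  refine Finset.sum_congr rfl fun k _ => ?_
  rw [map_sub, map_smul, map_smul]
  simp only [SchwartzMap.lineDerivOp_apply_eq_fderiv, Complex.real_smul]

/-- The derivative of the rotated configuration is jointly continuous in the angle and the
configuration. [folklore] -/
theorem continuous_rotCurveDeriv (i : Fin d) :
    Continuous fun p : ℝ × (Fin n → SpaceTime d) => rotCurveDeriv i p.2 p.1 := by
  refine continuous_pi fun k => ?_
  have hc : ∀ j : Fin (d + 1), Continuous fun p : ℝ × (Fin n → SpaceTime d) => p.2 k j :=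
    fun j => (EuclideanSpace.proj j).continuous.comp ((continuous_apply k).comp continuous_snd)
  have hcos : Continuous fun p : ℝ × (Fin n → SpaceTime d) => Real.cos p.1 :=
    Real.continuous_cos.comp continuous_fst
  have hsin : Continuous fun p : ℝ × (Fin n → SpaceTime d) => Real.sin p.1 :=
    Real.continuous_sin.comp continuous_fst
  refine (PiLp.continuous_toLp 2 _).comp (continuous_pi fun j => ?_)
  by_cases hj : j = 0
  · subst hj
    simp only [if_true]
    exact (hsin.neg.mul (hc 0)).sub (hcos.mul (hc _))
  · by_cases hji : j = i.succ
    · subst hji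
      simp only [Fin.succ_ne_zero, if_false, if_true]
      exact (hcos.mul (hc 0)).sub (hsin.mul (hc _))
    · simp only [hj, hji, if_false]
      exact continuous_const

/-! ### E1, infinitesimally, at Euclidean points -/

variable {S : SchwingerFamily (EuclideanSpace ℝ (Fin (d + 1)))} {𝔚 : (Fin n → Fin (d + 1) → ℂ) → ℂ}

/-- The Euclidean restriction of a function continuous on the time tube is continuous on the
time-ordered region. [folklore] -/
theorem continuousOn_euclideanPoint_of_continuousOn_timeTube (hGc : ContinuousOn 𝔚 (timeTube d n)) :
    ContinuousOn (fun x => 𝔚 (euclideanPoint x)) (timeOrderedRegion d n) :=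
  hGc.comp continuous_euclideanPoint.continuousOn fun _ hx => euclideanPoint_mem_timeTube hx

/-- **A uniform angle for compact sets**: for a compact `K ⊆ Ω` there is `ε > 0` such that the
rotations `R_φ x`, `|φ| < ε`, of all `x ∈ K` stay in the time-ordered region `Ω` (tube lemma). [folklore] -/
theorem exists_forall_planeRot_mem_timeOrderedRegion (i : Fin d) {K : Set (Fin n → SpaceTime d)}
    (hK : IsCompact K) (hKΩ : K ⊆ timeOrderedRegion d n) :
    ∃ ε : ℝ, 0 < ε ∧ ∀ φ : ℝ, |φ| < ε → ∀ x ∈ K,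
      (fun k => planeRot i φ (x k)) ∈ timeOrderedRegion d n := by
  set Ψ : ℝ × (Fin n → SpaceTime d) → (Fin n → SpaceTime d) := fun p k => planeRot i p.1 (p.2 k)
    with hΨ
  have hΨc : Continuous Ψ := continuous_planeRot_diag i
  have hO : IsOpen (Ψ ⁻¹' timeOrderedRegion d n) := isOpen_timeOrderedRegion.preimage hΨc
  have hsub : ({0} : Set ℝ) ×ˢ K ⊆ Ψ ⁻¹' timeOrderedRegion d n := by
    intro p hp
    rw [Set.mem_prod, Set.mem_singleton_iff] at hp
    obtain ⟨hp1, hp2⟩ := hp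
    rw [Set.mem_preimage]
    have : Ψ p = p.2 := by
      funext k; simp only [hΨ]; rw [hp1]; exact planeRot_zero_apply i (p.2 k)
    rw [this]
    exact hKΩ hp2
  obtain ⟨U, W, hUo, -, h0U, hKW, hUW⟩ := generalized_tube_lemma isCompact_singleton hK hO hsub
  obtain ⟨ε, hε, hεU⟩ := Metric.isOpen_iff.1 hUo 0 (h0U (Set.mem_singleton 0))
  refine ⟨ε, hε, fun φ hφ x hx => ?_⟩
  have hφU : φ ∈ U := hεU (mem_ball_zero_iff.2 (by simpa [Real.norm_eq_abs] using hφ))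
  have h := hUW (mk_mem_prod hφU (hKW hx))
  exact h

/-- The support of the diagonally rotated test function `G ∘ R_φ⁻¹` is the rotated support. [folklore] -/
theorem mem_tsupport_of_mem_tsupport_linActMulti (L : EuclideanSpace ℝ (Fin (d + 1)) ≃ₗᵢ[ℝ]
    EuclideanSpace ℝ (Fin (d + 1))) (G : 𝓢((Fin n → SpaceTime d), ℂ)) {x : Fin n → SpaceTime d}
    (hx : x ∈ tsupport ((linActMulti L G : 𝓢((Fin n → SpaceTime d), ℂ)) :
      (Fin n → SpaceTime d) → ℂ)) :
    (fun k => L.symm (x k)) ∈ tsupport (G : (Fin n → SpaceTime d) → ℂ) := by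
  set e : (Fin n → SpaceTime d) ≃ₜ (Fin n → SpaceTime d) :=
    (ContinuousLinearEquiv.piCongrRight fun _ : Fin n => L.symm.toContinuousLinearEquiv).toHomeomorph
  have hcomp : ((linActMulti L G : 𝓢((Fin n → SpaceTime d), ℂ)) : (Fin n → SpaceTime d) → ℂ) =
      (G : (Fin n → SpaceTime d) → ℂ) ∘ e := by
    funext y; rfl
  rw [hcomp, tsupport_comp_eq_preimage] at hx
  exact hx

/-- **E1 infinitesimally, at Euclidean points** (Osterwalder–Schrader I (1973), §4.2, (4.15):
`Y_{0i} Sₙ = 0`): if `𝔖ₙ` is Euclidean covariant, `𝔚` is continuous on the time tube with Euclidean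
restriction `𝔖ₙ` on time-ordered test functions, then `∫ 𝔚(ιx) (Y_i G)(x) dx = 0` for every
Schwartz `G` with compact support in the time-ordered region. Proof: for `|φ|` small the rotated
test function `G ∘ R_{−φ}` is time-ordered, so `φ ↦ ∫ 𝔚(ιx) G(R_{−φ} x) dx = 𝔖ₙ(G ∘ R_{−φ}) =
𝔖ₙ(G)` is constant; its derivative at `0`, computed under the integral sign (dominated convergence
on a compact neighbourhood of the support), is `∫ 𝔚(ιx) (Y_i G)(x) dx`. [cite: OsterwalderSchraderCMP1973, §4.2 eq. (4.15)] -/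
theorem integral_euclideanPoint_mul_rotGenFn_eq_zero (hE1 : S.IsEuclideanCovariant)
    (hGc : ContinuousOn 𝔚 (timeTube d n))
    (hS : ∀ F : 𝓢((Fin n → EuclideanSpace ℝ (Fin (d + 1))), ℂ), IsTimeOrdered F →
      S n F = ∫ x, 𝔚 (euclideanPoint x) * F x)
    (i : Fin d) (G : 𝓢((Fin n → SpaceTime d), ℂ))
    (hGΩ : tsupport (G : (Fin n → SpaceTime d) → ℂ) ⊆ timeOrderedRegion d n)
    (hGK : HasCompactSupport (G : (Fin n → SpaceTime d) → ℂ)) :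
    ∫ x, 𝔚 (euclideanPoint x) * rotGenFn i G x = 0 := by
  set K := tsupport (G : (Fin n → SpaceTime d) → ℂ) with hK
  have hKc : IsCompact K := hGK
  obtain ⟨ε, hε, hrot⟩ := exists_forall_planeRot_mem_timeOrderedRegion i hKc hGΩ
  have hcont := continuousOn_euclideanPoint_of_continuousOn_timeTube hGc
  -- the rotated test functions are time-ordered for `|φ| < ε`
  have hTO : ∀ φ : ℝ, |φ| < ε → IsTimeOrdered (linActMulti (planeRot i φ) G) := by
    intro φ hφ x hx
    have hx' := mem_tsupport_of_mem_tsupport_linActMulti (planeRot i φ) G hx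
    have h := hrot φ hφ _ hx'
    have heq : (fun k => planeRot i φ ((planeRot i φ).symm (x k))) = x :=
      funext fun k => (planeRot i φ).apply_symm_apply (x k)
    rwa [heq] at h
  -- the function `D(φ) = ∫ 𝔚(ιx) G(R_{-φ} x) dx` is constant near `0`
  set D : ℝ → ℂ := fun φ => ∫ x, 𝔚 (euclideanPoint x) * G (fun k => planeRot i (-φ) (x k)) with hD
  have hDconst : ∀ φ : ℝ, |φ| < ε → D φ = S n G := by
    intro φ hφ
    have h1 := hS _ (hTO φ hφ)
    rw [hE1.linActMulti] at h1
    rw [h1]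
    simp only [hD, linActMulti_apply, planeRot_symm_apply]
  have hD0 : HasDerivAt D 0 0 := by
    refine (hasDerivAt_const (0 : ℝ) (S n G)).congr_of_eventuallyEq ?_
    have hball : ball (0 : ℝ) ε ∈ 𝓝 (0 : ℝ) := ball_mem_nhds 0 hε
    filter_upwards [hball] with φ hφ
    exact hDconst φ (by simpa [Real.norm_eq_abs] using mem_ball_zero_iff.1 hφ)
  -- the derivative under the integral sign
  set F : ℝ → (Fin n → SpaceTime d) → ℂ := fun φ x =>
    𝔚 (euclideanPoint x) * G (fun k => planeRot i (-φ) (x k)) with hF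
  set F' : ℝ → (Fin n → SpaceTime d) → ℂ := fun φ x =>
    𝔚 (euclideanPoint x) * fderiv ℝ (G : (Fin n → SpaceTime d) → ℂ)
      (fun k => planeRot i (-φ) (x k)) (rotCurveDeriv i x φ) with hF'
  -- supports: if the `G`-factor at `R_{-φ} x` is nonzero then `x` lies in the compact `K'`
  set Ψ : ℝ × (Fin n → SpaceTime d) → (Fin n → SpaceTime d) := fun p k => planeRot i p.1 (p.2 k)
    with hΨ
  have hΨc : Continuous Ψ := continuous_planeRot_diag i
  set K' : Set (Fin n → SpaceTime d) := Ψ '' (closedBall (0 : ℝ) (ε / 2) ×ˢ K) with hK'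
  have hK'c : IsCompact K' := ((isCompact_closedBall 0 (ε / 2)).prod hKc).image hΨc
  have hK'Ω : K' ⊆ timeOrderedRegion d n := by
    rintro _ ⟨⟨φ, y⟩, ⟨hφ, hy⟩, rfl⟩
    refine hrot φ ?_ y hy
    have : |φ| ≤ ε / 2 := by simpa [Real.norm_eq_abs] using mem_closedBall_zero_iff.1 hφ
    linarith
  have hmemK' : ∀ φ : ℝ, |φ| ≤ ε / 2 → ∀ x : Fin n → SpaceTime d,
      (fun k => planeRot i (-φ) (x k)) ∈ K → x ∈ K' := by
    intro φ hφ x hx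
    refine ⟨(φ, fun k => planeRot i (-φ) (x k)), ⟨mem_closedBall_zero_iff.2 (by simpa [Real.norm_eq_abs] using hφ), hx⟩, ?_⟩
    funext k
    show planeRot i φ (planeRot i (-φ) (x k)) = x k
    rw [← planeRot_symm_apply]
    exact (planeRot i φ).apply_symm_apply (x k)
  -- continuity of the integrands
  have hFc : ∀ φ : ℝ, |φ| < ε → Continuous (F φ) := by
    intro φ hφ
    have hg : Continuous fun x : Fin n → SpaceTime d => G fun k => planeRot i (-φ) (x k) := by
      have : (fun x : Fin n → SpaceTime d => G fun k => planeRot i (-φ) (x k)) =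
          fun x => linActMulti (planeRot i φ) G x := by
        funext x; simp [linActMulti_apply, planeRot_symm_apply]
      rw [this]
      exact (linActMulti (planeRot i φ) G).continuous
    have hsupp : tsupport (fun x : Fin n → SpaceTime d => G fun k => planeRot i (-φ) (x k)) ⊆
        timeOrderedRegion d n := by
      have : (fun x : Fin n → SpaceTime d => G fun k => planeRot i (-φ) (x k)) =
          fun x => linActMulti (planeRot i φ) G x := by
        funext x; simp [linActMulti_apply, planeRot_symm_apply]
      rw [this]
      exact hTO φ hφ
    exact continuous_mul_of_tsupport_subset isOpen_timeOrderedRegion hcont hg hsupp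
  -- bounds
  obtain ⟨M, hM⟩ := hK'c.exists_bound_of_continuousOn (hcont.mono hK'Ω)
  have hfd : Continuous (fderiv ℝ (G : (Fin n → SpaceTime d) → ℂ)) :=
    (G.smooth 1).continuous_fderiv (by simp)
  obtain ⟨C₁, hC₁⟩ := hKc.exists_bound_of_continuousOn hfd.continuousOn
  obtain ⟨C₂, hC₂⟩ := ((isCompact_closedBall (0 : ℝ) (ε / 2)).prod hK'c).exists_bound_of_continuousOn
    (continuous_rotCurveDeriv i).continuousOn
  set B : ℝ := max M 0 * (max C₁ 0 * max C₂ 0) with hB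
  have hB0 : 0 ≤ B := by positivity
  set bound : (Fin n → SpaceTime d) → ℝ := K'.indicator fun _ => B with hbound
  have hbound_int : Integrable bound volume := by
    rw [hbound, integrable_indicator_iff hK'c.isClosed.measurableSet]
    exact integrableOn_const hK'c.measure_lt_top.ne
  -- pointwise domination of the derivative
  have hF'le : ∀ x, ∀ φ ∈ ball (0 : ℝ) (ε / 2), ‖F' φ x‖ ≤ bound x := by
    intro x φ hφ
    have hφ' : |φ| ≤ ε / 2 := le_of_lt (by simpa [Real.norm_eq_abs] using mem_ball_zero_iff.1 hφ)
    by_cases hx : (fun k => planeRot i (-φ) (x k)) ∈ K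
    · have hxK' : x ∈ K' := hmemK' φ hφ' x hx
      rw [hbound, indicator_of_mem hxK']
      have h1 : ‖𝔚 (euclideanPoint x)‖ ≤ max M 0 := (hM x hxK').trans (le_max_left _ _)
      have h2 : ‖fderiv ℝ (G : (Fin n → SpaceTime d) → ℂ) (fun k => planeRot i (-φ) (x k))‖ ≤
          max C₁ 0 := (hC₁ _ hx).trans (le_max_left _ _)
      have h3 : ‖rotCurveDeriv i x φ‖ ≤ max C₂ 0 :=
        (hC₂ (φ, x) ⟨mem_closedBall_zero_iff.2 (by simpa [Real.norm_eq_abs] using hφ'), hxK'⟩).trans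
          (le_max_left _ _)
      calc ‖F' φ x‖ = ‖𝔚 (euclideanPoint x)‖ *
            ‖fderiv ℝ (G : (Fin n → SpaceTime d) → ℂ) (fun k => planeRot i (-φ) (x k))
              (rotCurveDeriv i x φ)‖ := norm_mul _ _
        _ ≤ ‖𝔚 (euclideanPoint x)‖ *
            (‖fderiv ℝ (G : (Fin n → SpaceTime d) → ℂ) (fun k => planeRot i (-φ) (x k))‖ *
              ‖rotCurveDeriv i x φ‖) := by
            gcongr
            exact ContinuousLinearMap.le_opNorm _ _
        _ ≤ max M 0 * (max C₁ 0 * max C₂ 0) := by gcongr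
        _ = B := by rw [hB]
    · have h0 : fderiv ℝ (G : (Fin n → SpaceTime d) → ℂ) (fun k => planeRot i (-φ) (x k)) = 0 :=
        fderiv_of_notMem_tsupport ℝ hx
      have : F' φ x = 0 := by simp [hF', h0]
      rw [this, norm_zero]
      exact Set.indicator_nonneg (fun _ _ => hB0) x
  -- the integrands at `φ = 0`
  have hF0 : F 0 = fun x => 𝔚 (euclideanPoint x) * G x := by
    funext x
    simp [hF]
  have hF'0 : F' 0 = fun x => 𝔚 (euclideanPoint x) * rotGenFn i G x := by
    funext x
    simp only [hF']
    have hx0 : (fun k => planeRot i (-0) (x k)) = x := funext fun k => by simp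
    rw [hx0, fderiv_rotCurveDeriv_zero i G x]
  have hF0c : Continuous (F 0) := by
    rw [hF0]
    exact continuous_mul_of_tsupport_subset isOpen_timeOrderedRegion hcont G.continuous hGΩ
  have hF0i : Integrable (F 0) volume := by
    refine hF0c.integrable_of_hasCompactSupport ?_
    rw [hF0]
    exact hGK.mul_left
  have hF'0c : Continuous (F' 0) := by
    rw [hF'0]
    exact continuous_mul_of_tsupport_subset isOpen_timeOrderedRegion hcont (continuous_rotGenFn i G)
      ((tsupport_rotGenFn_subset i G).trans hGΩ)
  have hmeas : ∀ᶠ φ in 𝓝 (0 : ℝ), AEStronglyMeasurable (F φ) volume := by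
    filter_upwards [ball_mem_nhds (0 : ℝ) hε] with φ hφ
    exact (hFc φ (by simpa [Real.norm_eq_abs] using mem_ball_zero_iff.1 hφ)).aestronglyMeasurable
  have hderiv := hasDerivAt_integral_of_dominated_loc_of_deriv_le (μ := volume) (x₀ := (0 : ℝ))
    (F := F) (F' := F') (s := ball 0 (ε / 2)) (bound := bound) (ball_mem_nhds 0 (half_pos hε))
    hmeas hF0i hF'0c.aestronglyMeasurable (Eventually.of_forall hF'le) hbound_int
    (Eventually.of_forall fun x φ _ => (hasDerivAt_apply_planeRot_neg i G x φ).const_mul _)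
  have huniq : (0 : ℂ) = ∫ x, F' 0 x := hD0.unique hderiv.2
  rw [hF'0] at huniq
  exact huniq.symm

/-! ### Complex time shifts of Euclidean points and the complexified generator -/

/-- Real `n`-tuples as purely temporal configurations, `(timeLift s)_k = s_k e₀`. [folklore] -/
def timeLift (s : Fin n → ℝ) : Fin n → SpaceTime d := fun k => s k • e₀ d

/-- Time components of `timeLift`. [folklore] -/
@[simp] theorem timeLift_apply_zero (s : Fin n → ℝ) (k : Fin n) :
    (timeLift s : Fin n → SpaceTime d) k 0 = s k := by
  simp [timeLift]

/-- Spatial components of `timeLift` vanish. [folklore] -/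
@[simp] theorem timeLift_apply_succ (s : Fin n → ℝ) (k : Fin n) (j : Fin d) :
    (timeLift s : Fin n → SpaceTime d) k j.succ = 0 := by
  simp [timeLift, Fin.succ_ne_zero]

/-- `‖timeLift s‖ ≤ ‖s‖`. [folklore] -/
theorem norm_timeLift_le (s : Fin n → ℝ) : ‖(timeLift s : Fin n → SpaceTime d)‖ ≤ ‖s‖ := by
  refine (pi_norm_le_iff_of_nonneg (norm_nonneg s)).2 fun k => ?_
  rw [timeLift, norm_smul, e₀, PiLp.norm_single, norm_one, mul_one]
  exact norm_le_pi_norm s k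

/-- **The configuration `(a_k + i x⁰_k, x⃗_k)_k`**: the Euclidean point of `x` with its (purely
imaginary) times shifted by the complex vector `a ∈ ℂⁿ`; for real `a = u` these are the points
`u + i x⁰` of the time tube above the real configuration `(u_k, x⃗_k)_k`, for imaginary `a = is`
the Euclidean points of the time-translated configuration. [folklore] -/
def timeShiftC (a : Fin n → ℂ) (x : Fin n → SpaceTime d) : Fin n → Fin (d + 1) → ℂ :=
  withTimes (euclideanPoint x) fun k => a k + I * (x k 0 : ℂ)

/-- Time components of `timeShiftC`. [folklore] -/
@[simp] theorem timeShiftC_apply_zero (a : Fin n → ℂ) (x : Fin n → SpaceTime d) (k : Fin n) :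
    timeShiftC a x k 0 = a k + I * (x k 0 : ℂ) := rfl

/-- Spatial components of `timeShiftC`: real. [folklore] -/
@[simp] theorem timeShiftC_apply_succ (a : Fin n → ℂ) (x : Fin n → SpaceTime d) (k : Fin n)
    (j : Fin d) : timeShiftC a x k j.succ = (x k j.succ : ℂ) := by
  simp [timeShiftC]

/-- No shift: the Euclidean point. [folklore] -/
theorem timeShiftC_zero (x : Fin n → SpaceTime d) : timeShiftC 0 x = euclideanPoint x := by
  funext k μ
  refine Fin.cases ?_ (fun j => ?_) μ
  · simp
  · simp

/-- **Imaginary shifts are Euclidean time translations**: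
`timeShiftC (i s) x = ι(x + timeLift s)`. [folklore] -/
theorem timeShiftC_I_mul (s : Fin n → ℝ) (x : Fin n → SpaceTime d) :
    timeShiftC (fun k => I * (s k : ℂ)) x = euclideanPoint (x + timeLift s) := by
  funext k μ
  refine Fin.cases ?_ (fun j => ?_) μ
  · simp only [timeShiftC_apply_zero, euclideanPoint_apply_zero, Pi.add_apply, PiLp.add_apply,
      timeLift_apply_zero]
    push_cast
    ring
  · simp

/-- `timeShiftC a` is continuous in the configuration. [folklore] -/
theorem continuous_timeShiftC (a : Fin n → ℂ) :
    Continuous (timeShiftC a : (Fin n → SpaceTime d) → _) := by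
  refine continuous_pi fun k => continuous_pi fun μ => ?_
  refine Fin.cases ?_ (fun j => ?_) μ
  · simp only [timeShiftC_apply_zero]
    exact continuous_const.add (continuous_const.mul
      (continuous_ofReal.comp ((EuclideanSpace.proj (0 : Fin (d + 1))).continuous.comp
        (continuous_apply k))))
  · simp only [timeShiftC_apply_succ]
    exact continuous_ofReal.comp ((EuclideanSpace.proj j.succ).continuous.comp (continuous_apply k))

/-- `x ↦ succDiff (x⁰) k` is continuous. [folklore] -/
theorem continuous_succDiff_time (k : Fin n) :
    Continuous fun x : Fin n → SpaceTime d => succDiff (fun j => x j 0) k := by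
  have hc : Continuous fun x : Fin n → SpaceTime d => fun j => x j 0 :=
    continuous_pi fun j => (EuclideanSpace.proj (0 : Fin (d + 1))).continuous.comp (continuous_apply j)
  cases n with
  | zero => exact k.elim0
  | succ m =>
    refine Fin.cases ?_ (fun i => ?_) k
    · simp only [succDiff_zero]
      exact (EuclideanSpace.proj (0 : Fin (d + 1))).continuous.comp (continuous_apply _)
    · simp only [succDiff_succ]
      exact ((EuclideanSpace.proj (0 : Fin (d + 1))).continuous.comp (continuous_apply _)).sub
        ((EuclideanSpace.proj (0 : Fin (d + 1))).continuous.comp (continuous_apply _))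

/-- **When the shifted configuration lies in the time tube**: if the gaps of `Im a + x⁰` are
positive. [folklore] -/
theorem timeShiftC_mem_timeTube {a : Fin n → ℂ} {x : Fin n → SpaceTime d}
    (h : ∀ k, 0 < succDiff (fun j => (a j).im + x j 0) k) : timeShiftC a x ∈ timeTube d n := by
  refine ⟨fun k j => by simp, fun k => ?_⟩
  have heq : (fun j => timeShiftC a x j 0) = fun j => a j + I * (x j 0 : ℂ) := rfl
  rw [heq, ← succDiff_map Complex.im (fun a b => Complex.sub_im a b)]
  have : (fun j => (a j + I * (x j 0 : ℂ)).im) = fun j => (a j).im + x j 0 := by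
    funext j; simp
  rw [this]
  exact h k

/-- The gaps of `Im (λ u) + x⁰` for real `u`: `Im λ · gaps(u) + gaps(x⁰)`. [folklore] -/
theorem succDiff_im_mul_add (l : ℂ) (u : Fin n → ℝ) (x : Fin n → SpaceTime d) (k : Fin n) :
    succDiff (fun j => (l * (u j : ℂ)).im + x j 0) k =
      l.im * succDiff u k + succDiff (fun j => x j 0) k := by
  have h : (fun j => (l * (u j : ℂ)).im + x j 0) = l.im • u + fun j => x j 0 := by
    funext j; simp
  rw [h, succDiff_add, succDiff_smul']

/-- **The complexified rotation generator** `Ξ_a G (x) = ∑ₖ ((a_k + i x⁰_k) ∂_{e_i,k} G − i xⁱ_k ∂_{e₀,k} G)(x)`: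
for `a = 0` it is `i Y_i G`, and in general it is the generator whose pairing with
`𝔚((a_k + i x⁰_k, x⃗_k)_k)` continues the Euclidean identity `∫ 𝔚(ιx) Y_i G = 0` holomorphically in
the time shifts `a` (the time coordinate of the point enters as the holomorphic variable
`a_k + i x⁰_k`; Osterwalder–Schrader I (1973), (4.16)–(4.17), in position space). [cite: OsterwalderSchraderCMP1973, §4.2 eqs. (4.16)–(4.17)] -/
def shiftGenFn (i : Fin d) (a : Fin n → ℂ) (G : 𝓢((Fin n → SpaceTime d), ℂ))
    (x : Fin n → SpaceTime d) : ℂ :=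
  ∑ k, ((a k + I * (x k 0 : ℂ)) * ∂_{unitDir k i.succ} G x -
    I * (x k i.succ : ℂ) * ∂_{unitDir k (0 : Fin (d + 1))} G x)

/-- At `a = 0` the complexified generator is `i` times the rotation generator. [folklore] -/
theorem shiftGenFn_zero (i : Fin d) (G : 𝓢((Fin n → SpaceTime d), ℂ)) (x : Fin n → SpaceTime d) :
    shiftGenFn i 0 G x = I * rotGenFn i G x := by
  unfold shiftGenFn rotGenFn
  rw [Finset.mul_sum]
  refine Finset.sum_congr rfl fun k _ => ?_
  simp only [Pi.zero_apply, zero_add]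
  ring

/-- The complexified generator of `G` vanishes off the support of `G`. [folklore] -/
theorem shiftGenFn_eq_zero_of_notMem (i : Fin d) (a : Fin n → ℂ) (G : 𝓢((Fin n → SpaceTime d), ℂ))
    {x : Fin n → SpaceTime d} (hx : x ∉ tsupport (G : (Fin n → SpaceTime d) → ℂ)) :
    shiftGenFn i a G x = 0 := by
  unfold shiftGenFn
  refine Finset.sum_eq_zero fun k _ => ?_
  have h0 : fderiv ℝ (G : (Fin n → SpaceTime d) → ℂ) x = 0 := fderiv_of_notMem_tsupport ℝ hx
  simp [SchwartzMap.lineDerivOp_apply_eq_fderiv, h0]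

/-- The support of the complexified generator of `G` lies in the support of `G`. [folklore] -/
theorem tsupport_shiftGenFn_subset (i : Fin d) (a : Fin n → ℂ) (G : 𝓢((Fin n → SpaceTime d), ℂ)) :
    tsupport (shiftGenFn i a G) ⊆ tsupport (G : (Fin n → SpaceTime d) → ℂ) :=
  closure_minimal (fun _ hx => by_contra fun h => hx (shiftGenFn_eq_zero_of_notMem i a G h))
    (isClosed_tsupport _)

/-- The complexified generator is continuous in the configuration. [folklore] -/
theorem continuous_shiftGenFn (i : Fin d) (a : Fin n → ℂ) (G : 𝓢((Fin n → SpaceTime d), ℂ)) :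
    Continuous (shiftGenFn i a G) := by
  unfold shiftGenFn
  refine continuous_finsetSum _ fun k _ => ?_
  have hc : ∀ μ : Fin (d + 1), Continuous fun x : Fin n → SpaceTime d => ((x k μ : ℝ) : ℂ) :=
    fun μ => continuous_ofReal.comp ((EuclideanSpace.proj μ).continuous.comp (continuous_apply k))
  exact ((continuous_const.add (continuous_const.mul (hc 0))).mul
    (∂_{unitDir k i.succ} G).continuous).sub
    ((continuous_const.mul (hc i.succ)).mul (∂_{unitDir k (0 : Fin (d + 1))} G).continuous)

/-- The complexified generator is jointly continuous in a complex parameter of the shift and the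
configuration, along `a = λ u`. [folklore] -/
theorem continuous_shiftGenFn_line (i : Fin d) (u : Fin n → ℝ) (G : 𝓢((Fin n → SpaceTime d), ℂ)) :
    Continuous fun p : ℂ × (Fin n → SpaceTime d) =>
      shiftGenFn i (fun k => p.1 * (u k : ℂ)) G p.2 := by
  unfold shiftGenFn
  refine continuous_finsetSum _ fun k _ => ?_
  have hc : ∀ μ : Fin (d + 1), Continuous fun p : ℂ × (Fin n → SpaceTime d) => ((p.2 k μ : ℝ) : ℂ) :=
    fun μ => continuous_ofReal.comp ((EuclideanSpace.proj μ).continuous.comp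
      ((continuous_apply k).comp continuous_snd))
  have h1 : Continuous fun p : ℂ × (Fin n → SpaceTime d) => ∂_{unitDir k i.succ} G p.2 :=
    (∂_{unitDir k i.succ} G).continuous.comp continuous_snd
  have h2 : Continuous fun p : ℂ × (Fin n → SpaceTime d) => ∂_{unitDir k (0 : Fin (d + 1))} G p.2 :=
    (∂_{unitDir k (0 : Fin (d + 1))} G).continuous.comp continuous_snd
  exact (((continuous_fst.mul continuous_const).add (continuous_const.mul (hc 0))).mul h1).sub
    ((continuous_const.mul (hc i.succ)).mul h2)

/-- The complexified generator is entire in the shift parameter along `a = λ u`. [folklore] -/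
theorem differentiable_shiftGenFn_line (i : Fin d) (u : Fin n → ℝ) (G : 𝓢((Fin n → SpaceTime d), ℂ))
    (x : Fin n → SpaceTime d) :
    Differentiable ℂ fun l : ℂ => shiftGenFn i (fun k => l * (u k : ℂ)) G x := by
  unfold shiftGenFn
  refine Differentiable.fun_sum fun k _ => ?_
  exact (((differentiable_id.mul (differentiable_const _)).add (differentiable_const _)).mul
    (differentiable_const _)).sub (differentiable_const _)

/-- Directional derivatives commute with translations of the test function. [folklore] -/
theorem lineDerivOp_compSubConstCLM_apply (m ℓ : Fin n → SpaceTime d)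
    (G : 𝓢((Fin n → SpaceTime d), ℂ)) (y : Fin n → SpaceTime d) :
    ∂_{m} (SchwartzMap.compSubConstCLM ℂ ℓ G) y = ∂_{m} G (y - ℓ) := by
  simp only [SchwartzMap.lineDerivOp_apply_eq_fderiv]
  have h : ((SchwartzMap.compSubConstCLM ℂ ℓ G : 𝓢((Fin n → SpaceTime d), ℂ)) :
      (Fin n → SpaceTime d) → ℂ) = fun z => G (z - ℓ) := rfl
  rw [h, fderiv_comp_sub]

/-- **Imaginary shifts on the generator side**: `Ξ_{is} G (x) = i (Y_i G_s)(x + timeLift s)` for the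
time-translated test function `G_s = G(· − timeLift s)`. [folklore] -/
theorem shiftGenFn_I_mul (i : Fin d) (s : Fin n → ℝ) (G : 𝓢((Fin n → SpaceTime d), ℂ))
    (x : Fin n → SpaceTime d) :
    shiftGenFn i (fun k => I * (s k : ℂ)) G x =
      I * rotGenFn i (SchwartzMap.compSubConstCLM ℂ (timeLift s) G) (x + timeLift s) := by
  unfold shiftGenFn rotGenFn
  rw [Finset.mul_sum]
  refine Finset.sum_congr rfl fun k _ => ?_
  simp only [lineDerivOp_compSubConstCLM_apply, add_sub_cancel_right, Pi.add_apply, PiLp.add_apply,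
    timeLift_apply_zero, timeLift_apply_succ, add_zero]
  push_cast
  ring

/-! ### Uniform constants on compact sets of time-ordered configurations -/

/-- **Uniform admissible imaginary shifts**: for compact `K ⊆ Ω` and `u ∈ ℝⁿ` there is `δ > 0`
such that `μ · gaps(u)_k + gaps(x⁰)_k > 0` for all real `μ` with `|μ| < δ`, all `x ∈ K` and all `k`
(so that `(λu_k + i x⁰_k, x⃗_k)_k` stays in the time tube for `|Im λ| < δ`; tube lemma). [folklore] -/
theorem exists_forall_gap_pos {K : Set (Fin n → SpaceTime d)} (hK : IsCompact K)
    (hKΩ : K ⊆ timeOrderedRegion d n) (u : Fin n → ℝ) :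
    ∃ δ : ℝ, 0 < δ ∧ ∀ μ : ℝ, |μ| < δ → ∀ x ∈ K, ∀ k,
      0 < μ * succDiff u k + succDiff (fun j => x j 0) k := by
  set O : Set (ℝ × (Fin n → SpaceTime d)) :=
    {p | ∀ k, 0 < p.1 * succDiff u k + succDiff (fun j => p.2 j 0) k} with hO
  have hOo : IsOpen O := by
    simp only [hO, setOf_forall]
    refine isOpen_iInter_of_finite fun k => isOpen_lt continuous_const ?_
    exact (continuous_fst.mul continuous_const).add ((continuous_succDiff_time k).comp continuous_snd)
  have hsub : ({0} : Set ℝ) ×ˢ K ⊆ O := by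
    intro p hp
    rw [Set.mem_prod, Set.mem_singleton_iff] at hp
    intro k
    rw [hp.1, zero_mul, zero_add]
    exact succDiff_pos_of_mem_timeOrderedRegion (hKΩ hp.2) k
  obtain ⟨U, W, hUo, -, h0U, hKW, hUW⟩ := generalized_tube_lemma isCompact_singleton hK hOo hsub
  obtain ⟨δ, hδ, hδU⟩ := Metric.isOpen_iff.1 hUo 0 (h0U (Set.mem_singleton 0))
  refine ⟨δ, hδ, fun μ hμ x hx => ?_⟩
  have hμU : μ ∈ U := hδU (mem_ball_zero_iff.2 (by simpa [Real.norm_eq_abs] using hμ))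
  have h := hUW (mk_mem_prod hμU (hKW hx))
  exact h

/-- **Uniform admissible translations**: for compact `K ⊆ Ω` there is `ε > 0` such that every
translate `y` with `y − ℓ ∈ K`, `‖ℓ‖ < ε`, lies in `Ω`. [folklore] -/
theorem exists_forall_sub_mem_imp_mem {K : Set (Fin n → SpaceTime d)} (hK : IsCompact K)
    (hKΩ : K ⊆ timeOrderedRegion d n) :
    ∃ ε : ℝ, 0 < ε ∧ ∀ ℓ : Fin n → SpaceTime d, ‖ℓ‖ < ε → ∀ y : Fin n → SpaceTime d,
      y - ℓ ∈ K → y ∈ timeOrderedRegion d n := by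
  obtain ⟨ε, hε, hεΩ⟩ := hK.exists_thickening_subset_open isOpen_timeOrderedRegion hKΩ
  refine ⟨ε, hε, fun ℓ hℓ y hy => hεΩ ?_⟩
  rw [Metric.mem_thickening_iff]
  refine ⟨y - ℓ, hy, ?_⟩
  rw [dist_eq_norm, sub_sub_cancel]
  exact hℓ

/-- The support of a translate of a test function. [folklore] -/
theorem tsupport_compSubConstCLM_subset (ℓ : Fin n → SpaceTime d) (G : 𝓢((Fin n → SpaceTime d), ℂ)) :
    tsupport ((SchwartzMap.compSubConstCLM ℂ ℓ G : 𝓢((Fin n → SpaceTime d), ℂ)) :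
      (Fin n → SpaceTime d) → ℂ) ⊆ (fun y => y - ℓ) ⁻¹' tsupport (G : (Fin n → SpaceTime d) → ℂ) := by
  refine closure_minimal (fun y hy => ?_) ((isClosed_tsupport _).preimage (continuous_id.sub continuous_const))
  exact subset_tsupport _ hy

/-- A translate of a compactly supported test function is compactly supported. [folklore] -/
theorem hasCompactSupport_compSubConstCLM (ℓ : Fin n → SpaceTime d) {G : 𝓢((Fin n → SpaceTime d), ℂ)}
    (hG : HasCompactSupport (G : (Fin n → SpaceTime d) → ℂ)) :
    HasCompactSupport ((SchwartzMap.compSubConstCLM ℂ ℓ G : 𝓢((Fin n → SpaceTime d), ℂ)) :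
      (Fin n → SpaceTime d) → ℂ) := by
  have h : ((SchwartzMap.compSubConstCLM ℂ ℓ G : 𝓢((Fin n → SpaceTime d), ℂ)) :
      (Fin n → SpaceTime d) → ℂ) = (G : (Fin n → SpaceTime d) → ℂ) ∘ Homeomorph.addRight (-ℓ) := by
    funext y
    simp [sub_eq_add_neg]
  rw [h]
  exact hG.comp_homeomorph _

/-! ### The identity at real time shifts -/

/-- **The rotation identity continued to real time shifts** (Osterwalder–Schrader I (1973), §4.2,
(4.15)–(4.17), in position space): if `𝔖ₙ` is Euclidean covariant and `𝔚` is continuous on the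
time tube, holomorphic in the times, with Euclidean restriction `𝔖ₙ` on time-ordered test
functions, then for every Schwartz `G` with compact support in the time-ordered region and every
real `u ∈ ℝⁿ`,

  `∫ 𝔚((u_k + i x⁰_k, x⃗_k)_k) (Ξ_u G)(x) dx = 0`,

`Ξ_u G = ∑ₖ ((u_k + i x⁰_k) ∂_{e_i,k} G − i xⁱ_k ∂_{e₀,k} G)`. Proof: `λ ↦ ∫ 𝔚((λu_k + i x⁰_k, x⃗_k)_k)
(Ξ_{λu} G)(x) dx` is holomorphic on a strip `|Im λ| < δ` (dominated holomorphic parameter integral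
over the compact support), equals `i ∫ 𝔚(ιy) (Y_i G_{μu})(y) dy = 0` at `λ = iμ` for small real `μ`
(`timeShiftC_I_mul`, `shiftGenFn_I_mul`, translation invariance of Lebesgue measure and
`integral_euclideanPoint_mul_rotGenFn_eq_zero` for the translate `G_{μu}`), hence vanishes on the
strip by the identity theorem, in particular at `λ = 1`. [cite: OsterwalderSchraderCMP1973, §4.2 eqs. (4.15)–(4.17)] -/
theorem integral_timeShiftC_mul_shiftGenFn_eq_zero (hE1 : S.IsEuclideanCovariant)
    (hGc : ContinuousOn 𝔚 (timeTube d n)) (hGh : IsTimeHolomorphicOn 𝔚 (timeTube d n))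
    (hS : ∀ F : 𝓢((Fin n → EuclideanSpace ℝ (Fin (d + 1))), ℂ), IsTimeOrdered F →
      S n F = ∫ x, 𝔚 (euclideanPoint x) * F x)
    (i : Fin d) (G : 𝓢((Fin n → SpaceTime d), ℂ))
    (hGΩ : tsupport (G : (Fin n → SpaceTime d) → ℂ) ⊆ timeOrderedRegion d n)
    (hGK : HasCompactSupport (G : (Fin n → SpaceTime d) → ℂ)) (u : Fin n → ℝ) :
    ∫ x, 𝔚 (timeShiftC (fun k => (u k : ℂ)) x) * shiftGenFn i (fun k => (u k : ℂ)) G x = 0 := by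
  set K := tsupport (G : (Fin n → SpaceTime d) → ℂ) with hK
  have hKc : IsCompact K := hGK
  obtain ⟨δ, hδ, hgap⟩ := exists_forall_gap_pos hKc hGΩ u
  obtain ⟨ε, hε, htrans⟩ := exists_forall_sub_mem_imp_mem hKc hGΩ
  -- the holomorphic function of the shift parameter
  set F : ℂ → (Fin n → SpaceTime d) → ℂ := fun l x =>
    𝔚 (timeShiftC (fun k => l * (u k : ℂ)) x) * shiftGenFn i (fun k => l * (u k : ℂ)) G x with hF
  set f : ℂ → ℂ := fun l => ∫ x, F l x with hf
  set U : Set ℂ := {l : ℂ | -δ < l.im} ∩ {l : ℂ | l.im < δ} with hU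
  have hUo : IsOpen U :=
    (isOpen_lt continuous_const Complex.continuous_im).inter
      (isOpen_lt Complex.continuous_im continuous_const)
  have him : IsLinearMap ℝ fun w : ℂ => w.im :=
    ⟨fun a b => Complex.add_im a b, fun c a => Complex.smul_im c a⟩
  have hUc : Convex ℝ U := (convex_halfSpace_gt him _).inter (convex_halfSpace_lt him _)
  have hUabs : ∀ {l : ℂ}, l ∈ U ↔ |l.im| < δ := fun {l} => by
    simp only [hU, Set.mem_inter_iff, Set.mem_setOf_eq, abs_lt]
  -- membership in the time tube along the strip, over `K`
  have hmem : ∀ {l : ℂ}, |l.im| < δ → ∀ x ∈ K, timeShiftC (fun k => l * (u k : ℂ)) x ∈ timeTube d n := by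
    intro l hl x hx
    refine timeShiftC_mem_timeTube fun k => ?_
    rw [succDiff_im_mul_add]
    exact hgap l.im hl x hx k
  -- the integrand vanishes off `K`
  have hF0 : ∀ l : ℂ, ∀ x ∉ K, F l x = 0 := fun l x hx => by
    simp only [hF, shiftGenFn_eq_zero_of_notMem i _ G hx, mul_zero]
  -- continuity of the integrand for `l ∈ U`
  have hFc : ∀ {l : ℂ}, |l.im| < δ → Continuous (F l) := by
    intro l hl
    set O : Set (Fin n → SpaceTime d) := {x | ∀ k, 0 < l.im * succDiff u k + succDiff (fun j => x j 0) k}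
      with hO
    have hOo : IsOpen O := by
      simp only [hO, setOf_forall]
      exact isOpen_iInter_of_finite fun k =>
        isOpen_lt continuous_const (continuous_const.add (continuous_succDiff_time k))
    have hKO : K ⊆ O := fun x hx k => hgap l.im hl x hx k
    have hWc : ContinuousOn (fun x => 𝔚 (timeShiftC (fun k => l * (u k : ℂ)) x)) O := by
      refine hGc.comp (continuous_timeShiftC _).continuousOn fun x hx => ?_
      exact timeShiftC_mem_timeTube fun k => by rw [succDiff_im_mul_add]; exact hx k
    exact continuous_mul_of_tsupport_subset hOo hWc (continuous_shiftGenFn i _ G)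
      ((tsupport_shiftGenFn_subset i _ G).trans hKO)
  -- holomorphy on the strip
  have hfd : DifferentiableOn ℂ f U := by
    refine Literature.Analysis.Complex.differentiableOn_integral_of_dominated (F := F) (μ := volume)
      (fun l hl => (hFc (hUabs.1 hl)).aestronglyMeasurable) (Eventually.of_forall fun x => ?_) ?_
    · -- holomorphy in `l` for every `x`
      by_cases hx : x ∈ K
      · have hz : euclideanPoint x ∈ timeTube d n := euclideanPoint_mem_timeTube (hGΩ hx)
        have haff : Differentiable ℂ fun l : ℂ => fun k : Fin n => l * (u k : ℂ) + I * (x k 0 : ℂ) :=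
          differentiable_pi.2 fun k => (differentiable_id.mul (differentiable_const _)).add
            (differentiable_const _)
        have h1 : DifferentiableOn ℂ (fun l : ℂ => 𝔚 (timeShiftC (fun k => l * (u k : ℂ)) x)) U := by
          have h := (hGh _ hz).comp haff.differentiableOn (fun l hl => by
            show withTimes (euclideanPoint x) (fun k => l * (u k : ℂ) + I * (x k 0 : ℂ)) ∈ timeTube d n
            exact hmem (hUabs.1 hl) x hx)
          exact h
        exact h1.mul (differentiable_shiftGenFn_line i u G x).differentiableOn
      · have : (fun l => F l x) = fun _ => 0 := funext fun l => hF0 l x hx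
        rw [this]
        exact differentiableOn_const _
    · -- local domination
      intro l₀ hl₀
      have hl₀' : |l₀.im| < δ := hUabs.1 hl₀
      set R : ℝ := (δ - |l₀.im|) / 2 with hR
      have hR0 : 0 < R := by rw [hR]; linarith
      have hballU : ∀ l ∈ closedBall l₀ R, |l.im| < δ := by
        intro l hl
        have h1 : |l.im - l₀.im| ≤ R := by
          have := abs_im_le_norm (l - l₀)
          rw [sub_im] at this
          exact this.trans (mem_closedBall_iff_norm.1 hl)
        have h2 : |l.im| ≤ |l₀.im| + R := by
          have := abs_sub_abs_le_abs_sub l.im l₀.im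
          linarith
        linarith
      refine ⟨R, hR0, fun l hl => hUabs.2 (hballU l (ball_subset_closedBall hl)), ?_⟩
      -- bound of `𝔚` on the compact image of `closedBall l₀ R × K`
      set Z : Set (Fin n → Fin (d + 1) → ℂ) :=
        (fun p : ℂ × (Fin n → SpaceTime d) => timeShiftC (fun k => p.1 * (u k : ℂ)) p.2) ''
          (closedBall l₀ R ×ˢ K) with hZ
      have hTc : Continuous fun p : ℂ × (Fin n → SpaceTime d) =>
          timeShiftC (fun k => p.1 * (u k : ℂ)) p.2 := by
        refine continuous_pi fun k => continuous_pi fun μ => ?_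
        refine Fin.cases ?_ (fun j => ?_) μ
        · simp only [timeShiftC_apply_zero]
          exact (continuous_fst.mul continuous_const).add (continuous_const.mul
            (continuous_ofReal.comp ((EuclideanSpace.proj (0 : Fin (d + 1))).continuous.comp
              ((continuous_apply k).comp continuous_snd))))
        · simp only [timeShiftC_apply_succ]
          exact continuous_ofReal.comp ((EuclideanSpace.proj j.succ).continuous.comp
            ((continuous_apply k).comp continuous_snd))
      have hZc : IsCompact Z := ((isCompact_closedBall l₀ R).prod hKc).image hTc
      have hZT : Z ⊆ timeTube d n := by
        rintro _ ⟨⟨l, x⟩, ⟨hl, hx⟩, rfl⟩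
        exact hmem (hballU l hl) x hx
      obtain ⟨M, hM⟩ := hZc.exists_bound_of_continuousOn (hGc.mono hZT)
      -- bound of the generator factor, uniformly on the ball
      set ρ : ℝ := ‖l₀‖ + R with hρ
      set bound : (Fin n → SpaceTime d) → ℝ := fun x => max M 0 *
        ∑ k, ((ρ * |u k| + |x k 0|) * ‖∂_{unitDir k i.succ} G x‖ +
          |x k i.succ| * ‖∂_{unitDir k (0 : Fin (d + 1))} G x‖) with hbound
      have hbc : Continuous bound := by
        refine continuous_const.mul (continuous_finsetSum _ fun k _ => ?_)
        have hc : ∀ μ : Fin (d + 1), Continuous fun x : Fin n → SpaceTime d => |x k μ| :=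
          fun μ => ((EuclideanSpace.proj μ).continuous.comp (continuous_apply k)).abs
        exact ((continuous_const.add (hc 0)).mul (∂_{unitDir k i.succ} G).continuous.norm).add
          ((hc i.succ).mul (∂_{unitDir k (0 : Fin (d + 1))} G).continuous.norm)
      have hbs : HasCompactSupport bound := by
        refine HasCompactSupport.mul_left ?_
        refine hGK.mono' fun x hx => ?_
        by_contra hxK
        have h0 : fderiv ℝ (G : (Fin n → SpaceTime d) → ℂ) x = 0 := fderiv_of_notMem_tsupport ℝ hxK
        apply hx
        simp [SchwartzMap.lineDerivOp_apply_eq_fderiv, h0]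
      have hb0 : ∀ x, 0 ≤ bound x := fun x => by
        rw [hbound]
        exact mul_nonneg (le_max_right _ _) (Finset.sum_nonneg fun k _ => by positivity)
      refine ⟨bound, hbc.integrable_of_hasCompactSupport hbs, Eventually.of_forall fun x l hl => ?_⟩
      by_cases hx : x ∈ K
      · have hlR : l ∈ closedBall l₀ R := ball_subset_closedBall hl
        have hW : ‖𝔚 (timeShiftC (fun k => l * (u k : ℂ)) x)‖ ≤ max M 0 :=
          (hM _ ⟨(l, x), ⟨hlR, hx⟩, rfl⟩).trans (le_max_left _ _)
        have hlρ : ‖l‖ ≤ ρ := by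
          rw [hρ]
          have := mem_closedBall_iff_norm.1 hlR
          calc ‖l‖ = ‖l₀ + (l - l₀)‖ := by rw [add_sub_cancel]
            _ ≤ ‖l₀‖ + ‖l - l₀‖ := norm_add_le _ _
            _ ≤ ‖l₀‖ + R := by linarith
        have hgen : ‖shiftGenFn i (fun k => l * (u k : ℂ)) G x‖ ≤
            ∑ k, ((ρ * |u k| + |x k 0|) * ‖∂_{unitDir k i.succ} G x‖ +
              |x k i.succ| * ‖∂_{unitDir k (0 : Fin (d + 1))} G x‖) := by
          unfold shiftGenFn
          refine (norm_sum_le _ _).trans (Finset.sum_le_sum fun k _ => ?_)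
          refine (norm_sub_le _ _).trans (add_le_add ?_ ?_)
          · rw [norm_mul]
            refine mul_le_mul_of_nonneg_right ?_ (norm_nonneg _)
            refine (norm_add_le _ _).trans (add_le_add ?_ ?_)
            · rw [norm_mul, Complex.norm_real, Real.norm_eq_abs]
              exact mul_le_mul_of_nonneg_right hlρ (abs_nonneg _)
            · rw [norm_mul, Complex.norm_I, one_mul, Complex.norm_real, Real.norm_eq_abs]
          · rw [norm_mul, norm_mul, Complex.norm_I, one_mul, Complex.norm_real, Real.norm_eq_abs]
        calc ‖F l x‖ = ‖𝔚 (timeShiftC (fun k => l * (u k : ℂ)) x)‖ *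
              ‖shiftGenFn i (fun k => l * (u k : ℂ)) G x‖ := norm_mul _ _
          _ ≤ max M 0 * ∑ k, ((ρ * |u k| + |x k 0|) * ‖∂_{unitDir k i.succ} G x‖ +
              |x k i.succ| * ‖∂_{unitDir k (0 : Fin (d + 1))} G x‖) := by gcongr
          _ = bound x := by rw [hbound]
      · rw [hF0 l x hx, norm_zero]
        exact hb0 x
  -- zeros on the imaginary axis: Euclidean time translations and E1
  have hzero : ∀ μ : ℝ, |μ| < δ → |μ| * ‖u‖ < ε → f ((μ : ℂ) * I) = 0 := by
    intro μ hμ hμε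
    set sv : Fin n → ℝ := μ • u with hsv
    set ℓ : Fin n → SpaceTime d := timeLift sv with hℓ_def
    set G' : 𝓢((Fin n → SpaceTime d), ℂ) := SchwartzMap.compSubConstCLM ℂ ℓ G with hG'
    have hℓ : ‖ℓ‖ < ε := by
      refine (norm_timeLift_le sv).trans_lt ?_
      rw [hsv, norm_smul, Real.norm_eq_abs]
      exact hμε
    have hG'Ω : tsupport ((G' : 𝓢((Fin n → SpaceTime d), ℂ)) : (Fin n → SpaceTime d) → ℂ) ⊆
        timeOrderedRegion d n :=
      fun y hy => htrans ℓ hℓ y (tsupport_compSubConstCLM_subset ℓ G hy)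
    have hG'K : HasCompactSupport ((G' : 𝓢((Fin n → SpaceTime d), ℂ)) : (Fin n → SpaceTime d) → ℂ) :=
      hasCompactSupport_compSubConstCLM ℓ hGK
    have hS1 := integral_euclideanPoint_mul_rotGenFn_eq_zero hE1 hGc hS i G' hG'Ω hG'K
    have hl : (fun k => (μ : ℂ) * I * (u k : ℂ)) = fun k => I * (sv k : ℂ) := by
      funext k
      simp only [hsv, Pi.smul_apply, smul_eq_mul]
      push_cast
      ring
    have hFμ : F ((μ : ℂ) * I) = fun x => 𝔚 (euclideanPoint (x + ℓ)) * (I * rotGenFn i G' (x + ℓ)) := by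
      funext x
      simp only [hF]
      rw [hl, timeShiftC_I_mul, shiftGenFn_I_mul]
    calc f ((μ : ℂ) * I) = ∫ x, 𝔚 (euclideanPoint (x + ℓ)) * (I * rotGenFn i G' (x + ℓ)) := by
          simp only [hf]
          rw [hFμ]
      _ = ∫ y, 𝔚 (euclideanPoint y) * (I * rotGenFn i G' y) :=
          integral_add_right_eq_self (μ := volume)
            (fun y => 𝔚 (euclideanPoint y) * (I * rotGenFn i G' y)) ℓ
      _ = I * ∫ y, 𝔚 (euclideanPoint y) * rotGenFn i G' y := by
          rw [← integral_const_mul]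
          congr 1
          funext y
          ring
      _ = 0 := by rw [hS1, mul_zero]
  -- the identity theorem on the strip
  have hanal : AnalyticOnNhd ℂ f U := hfd.analyticOnNhd hUo
  have h0U : (0 : ℂ) ∈ U := hUabs.2 (by simp [hδ])
  have hfreq : ∃ᶠ l in 𝓝[≠] (0 : ℂ), f l = 0 := by
    have htend : Tendsto (fun s : ℝ => (s : ℂ) * I) (𝓝[>] 0) (𝓝[≠] 0) := by
      have hc : Continuous fun s : ℝ => (s : ℂ) * I := continuous_ofReal.mul continuous_const
      have h1 : Tendsto (fun s : ℝ => (s : ℂ) * I) (𝓝[>] 0) (𝓝[{0}ᶜ] (((0 : ℝ) : ℂ) * I)) :=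
        hc.continuousWithinAt.tendsto_nhdsWithin fun s hs =>
          mul_ne_zero (ofReal_ne_zero.2 (ne_of_gt hs)) I_ne_zero
      simpa using h1
    have hev : ∀ᶠ s : ℝ in 𝓝[>] 0, f ((s : ℂ) * I) = 0 := by
      have h1 : ∀ᶠ s : ℝ in 𝓝 (0 : ℝ), |s| < δ := by
        filter_upwards [ball_mem_nhds (0 : ℝ) hδ] with s hs
        simpa [Real.norm_eq_abs] using mem_ball_zero_iff.1 hs
      have hε' : 0 < ε / (‖u‖ + 1) := div_pos hε (by positivity)
      have h2 : ∀ᶠ s : ℝ in 𝓝 (0 : ℝ), |s| * ‖u‖ < ε := by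
        filter_upwards [ball_mem_nhds (0 : ℝ) hε'] with s hs
        have hs' : |s| < ε / (‖u‖ + 1) := by simpa [Real.norm_eq_abs] using mem_ball_zero_iff.1 hs
        have hu : 0 ≤ ‖u‖ := norm_nonneg u
        calc |s| * ‖u‖ ≤ |s| * (‖u‖ + 1) := by gcongr; linarith
          _ < ε / (‖u‖ + 1) * (‖u‖ + 1) := by gcongr
          _ = ε := div_mul_cancel₀ ε (by positivity)
      filter_upwards [h1.filter_mono nhdsWithin_le_nhds, h2.filter_mono nhdsWithin_le_nhds]
        with s hs1 hs2 using hzero s hs1 hs2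
    exact htend.frequently hev.frequently
  have hEq := hanal.eqOn_zero_of_preconnected_of_frequently_eq_zero hUc.isPreconnected h0U hfreq
  have h1U : (1 : ℂ) ∈ U := hUabs.2 (by simp [hδ])
  have h1 := hEq h1U
  simpa [hf, hF] using h1


end Literature.MathematicalPhysics.QuantumFieldTheory
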